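import Mathlib.RingTheory.RegularLocalRing.Defs
import Mathlib.RingTheory.Ideal.Height
import Mathlib.RingTheory.Ideal.MinimalPrime.Noetherian
import Mathlib.RingTheory.Localization.AtPrime.Basic
import Mathlib.RingTheory.Localization.FractionRing
import Mathlib.RingTheory.FiniteType
import HarnessLib

/-!
# `RuledResidues.NonRuledCofinite` (crux stmt-ResolutionOfSingularities-18076), line
# `regular-atlas`, stub `stub_exceptionalPrimesFinite`: a birational affine chart is an
# isomorphism off finitely many prime divisors

For finitely generated `k`-subalgebras `R ≤ B` of a field `K` with `Frac R = K`, the height-one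
primes `𝔭` of `B` at which `B_𝔭` is a regular local ring but `R_{𝔭 ∩ R}` is not are finitely many.

Proof. The finitely many generators of `B` over `k` are fractions of elements of `R`, so they have a
common denominator `0 ≠ f ∈ R` (`exists_common_denominator`); by induction over `k[t] = B` every
`b ∈ B` satisfies `b fⁿ ∈ R` for some `n` (`exists_pow_mul_mem_of_mem_adjoin`). For a prime `𝔭` of
`B` NOT containing `f`, the canonical local map `R_{𝔭 ∩ R} → B_𝔭` is then bijective
(`localRingHom_bijective_of_denominator`: injective because `R ⊆ B` are domains, surjective
because `b / s = (b fᵐ⁺ⁿ) / (s fᵐ⁺ⁿ)` with numerator and denominator in `R`), so regularity of `B_𝔭`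
transports to `R_{𝔭 ∩ R}` (`IsRegularLocalRing.of_ringEquiv`). Hence every prime of the set contains
`f`; being of height one, it is a minimal prime of the nonzero principal ideal `(f) ⊆ B`
(`mem_minimalPrimes_of_height_eq_one`), and a Noetherian ring has finitely many minimal primes over
an ideal (`Ideal.finite_minimalPrimes_of_isNoetherianRing`). The hypothesis `height = 1` is
essential (without it the set can be infinite: the normalisation of `cusp × 𝔸¹`).

Source: standard (e.g. Hartshorne, *Algebraic Geometry*, I.4.5: birational varieties have isomorphic
dense opens; here in the affine algebraic form "`R[1/f] = B[1/f]` for a common denominator `f`").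
Only Mathlib is used. [folklore]
-/

noncomputable section

set_option linter.dupNamespace false -- mandated namespace of this single-conjunct summit

namespace Summit.ResolutionOfSingularities.ResolutionOfSingularities.Theorems.RuledResiduesNonRuledCofinite

/-- **Localisation off a common denominator.** Let `φ : A → B` be an injective ring map into a
domain and `f ∈ A` an element such that every `b ∈ B` satisfies `b · φ(f)ⁿ ∈ φ(A)` for some `n`
(i.e. `B ⊆ A[1/f]`). Then for every prime `𝔭` of `B` not containing `φ(f)` the canonical local
homomorphism `A_{φ⁻¹𝔭} → B_𝔭` is bijective. [folklore] -/
theorem localRingHom_bijective_of_denominator {A B : Type*} [CommRing A] [CommRing B] [IsDomain B]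
    (φ : A →+* B) (hφ : Function.Injective φ) (f : A)
    (hf : ∀ b : B, ∃ n : ℕ, ∃ a : A, b * φ f ^ n = φ a)
    (𝔭 : Ideal B) [𝔭.IsPrime] (hfp : φ f ∉ 𝔭) :
    Function.Bijective (Localization.localRingHom (𝔭.comap φ) 𝔭 φ rfl) := by
  constructor
  · rw [injective_iff_map_eq_zero]
    intro x hx
    obtain ⟨⟨a, s⟩, rfl⟩ := IsLocalization.mk'_surjective (𝔭.comap φ).primeCompl x
    rw [Localization.localRingHom_mk', IsLocalization.mk'_eq_zero_iff] at hx
    obtain ⟨m, hm⟩ := hx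
    have hm0 : (m : B) ≠ 0 := fun h => m.2 (h ▸ 𝔭.zero_mem)
    have ha : a = 0 := hφ (by rw [(mul_eq_zero.mp hm).resolve_left hm0, map_zero])
    subst ha
    exact IsLocalization.mk'_zero _
  · intro y
    obtain ⟨⟨b, s⟩, rfl⟩ := IsLocalization.mk'_surjective 𝔭.primeCompl y
    obtain ⟨n, a, ha⟩ := hf b
    obtain ⟨m, a', ha'⟩ := hf s
    have hfk : ∀ k : ℕ, φ f ^ k ∉ 𝔭 := fun k h => hfp (‹𝔭.IsPrime›.mem_of_pow_mem k h)
    have ha'𝔮 : a' ∉ 𝔭.comap φ := by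
      rw [Ideal.mem_comap, ← ha']
      exact ‹𝔭.IsPrime›.mul_notMem s.2 (hfk m)
    have hden : a' * f ^ n ∉ 𝔭.comap φ := by
      refine (inferInstance : (𝔭.comap φ).IsPrime).mul_notMem ha'𝔮 ?_
      rw [Ideal.mem_comap, map_pow]
      exact hfk n
    refine ⟨IsLocalization.mk' (Localization.AtPrime (𝔭.comap φ)) (a * f ^ m)
      (⟨a' * f ^ n, hden⟩ : (𝔭.comap φ).primeCompl), ?_⟩
    rw [Localization.localRingHom_mk']
    refine IsLocalization.mk'_eq_of_eq' ?_
    simp only [map_mul, map_pow]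
    rw [← ha, ← ha']
    ring

/-- Finitely many elements of the fraction field `K` of a subalgebra `R ⊆ K` have a common
denominator `0 ≠ f ∈ R`. [folklore] -/
theorem exists_common_denominator {k K : Type*} [Field k] [Field K] [Algebra k K]
    (R : Subalgebra k K) [IsFractionRing R K] (t : Finset K) :
    ∃ f : R, f ≠ 0 ∧ ∀ x ∈ t, x * (f : K) ∈ R := by
  classical
  induction t using Finset.induction_on with
  | empty => exact ⟨1, one_ne_zero, by simp⟩
  | insert x t _ ih =>
    obtain ⟨f, hf0, hf⟩ := ih
    obtain ⟨a, d, hd, hx⟩ := IsFractionRing.div_surjective (A := R) x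
    have hd0 : d ≠ 0 := nonZeroDivisors.ne_zero hd
    have hdK : (d : K) ≠ 0 := fun h => hd0 (Subtype.ext h)
    refine ⟨d * f, mul_ne_zero hd0 hf0, fun y hy => ?_⟩
    rcases Finset.mem_insert.mp hy with rfl | hy
    · rw [← hx, Subalgebra.algebraMap_apply, Subalgebra.algebraMap_apply, Subalgebra.coe_mul,
        ← mul_assoc, div_mul_cancel₀ _ hdK]
      exact R.mul_mem a.2 f.2
    · rw [Subalgebra.coe_mul, mul_comm (d : K), ← mul_assoc]
      exact R.mul_mem (hf y hy) d.2

/-- If every generator `x ∈ t` satisfies `x f ∈ R` for some `f ∈ R`, then every element `b` of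
`k[t]` satisfies `b fⁿ ∈ R` for some `n` (i.e. `k[t] ⊆ R[1/f]`). [folklore] -/
theorem exists_pow_mul_mem_of_mem_adjoin {k K : Type*} [Field k] [Field K] [Algebra k K]
    (R : Subalgebra k K) {f : K} (hfR : f ∈ R) {t : Set K} (ht : ∀ x ∈ t, x * f ∈ R)
    {b : K} (hb : b ∈ Algebra.adjoin k t) : ∃ n : ℕ, b * f ^ n ∈ R := by
  induction hb using Algebra.adjoin_induction with
  | mem x hx => exact ⟨1, by simpa using ht x hx⟩
  | algebraMap c => exact ⟨0, by simp⟩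
  | add x y _ _ hx hy =>
    obtain ⟨n, hn⟩ := hx
    obtain ⟨m, hm⟩ := hy
    refine ⟨n + m, ?_⟩
    have : (x + y) * f ^ (n + m) = x * f ^ n * f ^ m + y * f ^ m * f ^ n := by ring
    rw [this]
    exact R.add_mem (R.mul_mem hn (R.pow_mem hfR m)) (R.mul_mem hm (R.pow_mem hfR n))
  | mul x y _ _ hx hy =>
    obtain ⟨n, hn⟩ := hx
    obtain ⟨m, hm⟩ := hy
    refine ⟨n + m, ?_⟩
    have : x * y * f ^ (n + m) = x * f ^ n * (y * f ^ m) := by ring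
    rw [this]
    exact R.mul_mem hn hm

/-- In a domain, a height-one prime containing a nonzero ideal `I` is a minimal prime of `I`.
[folklore] -/
theorem mem_minimalPrimes_of_height_eq_one {A : Type*} [CommRing A] [IsDomain A]
    {I p : Ideal A} [p.IsPrime] (hI : I ≠ ⊥) (hIp : I ≤ p) (hp : p.height = 1) :
    p ∈ I.minimalPrimes := by
  have : p.FiniteHeight := ⟨Or.inr (by simp [hp])⟩
  refine Ideal.mem_minimalPrimes_of_height_eq hIp ?_
  rw [hp]
  exact Order.one_le_iff_ne_zero.mpr (mt Ideal.height_eq_zero_iff_eq_bot.mp hI)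

/-- **A birational affine chart is an isomorphism off finitely many prime divisors** (stub
`stub_exceptionalPrimesFinite` of line `regular-atlas`). For finitely generated `k`-subalgebras
`R ≤ B` of `K = Frac R`, the height-one primes `𝔭` of `B` at which `B_𝔭` is regular but
`R_{𝔭 ∩ R}` is not are finitely many: they all contain a common denominator `0 ≠ f ∈ R` of the
generators of `B` (off `f` the local rings agree), hence are minimal over `(f)`. [folklore] -/
theorem stub_exceptionalPrimesFinite (k K : Type) [Field k] [Field K] [Algebra k K]
    (R B : Subalgebra k K) (hRB : R ≤ B) (hR : R.FG) (hB : B.FG) (hfr : IsFractionRing R K) :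
    {𝔭 : PrimeSpectrum B | 𝔭.asIdeal.height = 1 ∧
      IsRegularLocalRing (Localization.AtPrime 𝔭.asIdeal) ∧
      ¬ IsRegularLocalRing (Localization.AtPrime
        (𝔭.asIdeal.comap (Subalgebra.inclusion hRB).toRingHom))}.Finite := by
  classical
  -- `hR` (part of the registered signature) is idle: only `B` Noetherian and `Frac R = K` are used
  obtain ⟨-, -⟩ := hR
  haveI := hfr
  -- `B` is Noetherian
  haveI : Algebra.FiniteType k B := B.fg_iff_finiteType.mp hB
  haveI : IsNoetherianRing B := Algebra.FiniteType.isNoetherianRing k B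
  -- a common denominator `f ∈ R ∖ 0` of the generators of `B`
  obtain ⟨t, ht⟩ := hB
  obtain ⟨f, hf0, hf⟩ := exists_common_denominator R t
  set φ : R →+* B := (Subalgebra.inclusion hRB).toRingHom with hφ
  have hφinj : Function.Injective φ := Subalgebra.inclusion_injective hRB
  have hden : ∀ b : B, ∃ n : ℕ, ∃ a : R, b * φ f ^ n = φ a := by
    intro b
    have hb : (b : K) ∈ Algebra.adjoin k (t : Set K) := by rw [ht]; exact b.2
    obtain ⟨n, hn⟩ := exists_pow_mul_mem_of_mem_adjoin R f.2 hf hb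
    refine ⟨n, ⟨_, hn⟩, Subtype.ext ?_⟩
    simp [hφ, Subalgebra.coe_inclusion]
  have hspan : Ideal.span {φ f} ≠ ⊥ := by
    rw [Ne, Ideal.span_singleton_eq_bot]
    exact (map_ne_zero_iff φ hφinj).mpr hf0
  -- the set injects into the minimal primes over `(f) ⊆ B`
  refine ((Ideal.finite_minimalPrimes_of_isNoetherianRing B (Ideal.span {φ f})).preimage
    (f := PrimeSpectrum.asIdeal) fun _ _ _ _ h => PrimeSpectrum.ext h).subset ?_
  rintro 𝔭 ⟨hht, hreg, hnreg⟩
  have hfp : φ f ∈ 𝔭.asIdeal := by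
    by_contra hfp
    apply hnreg
    haveI := hreg
    exact IsRegularLocalRing.of_ringEquiv (RingEquiv.ofBijective _
      (localRingHom_bijective_of_denominator φ hφinj f hden 𝔭.asIdeal hfp)).symm
  exact mem_minimalPrimes_of_height_eq_one hspan ((Ideal.span_singleton_le_iff_mem _).mpr hfp) hht

end Summit.ResolutionOfSingularities.ResolutionOfSingularities.Theorems.RuledResiduesNonRuledCofinite

end
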